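import Literature.MathematicalPhysics.QuantumFieldTheory.Balaban1983to89.T3AlphaInputsACTwoRunLevel
import Literature.MathematicalPhysics.QuantumFieldTheory.Balaban1983to89.T3Thresholds

/-!
# Crux-ideate sketch g8 (ideator 1, stmt-QuantumFields-19201 / live twin stmt-QuantumFields-19935) — card 8 «chart-factorisation-schwarz»

SAME-CHART SCHWARZ TRANSFER FOR THE TWO-CUTOFF ROW `PolymerCauchyMinAtT` (the (C) piece of `TwoRunMinT`, TARGET v16).

Print's structure rows make every term the lane carries in `PT : TermFn F` a FIXED BIRTH-STEP CHART read at the CURRENT background: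
[Balaban1985UV3] (27)–(29) p.263 (the chart variables `B(c) = (1/i)·log[V(Γ^{(j)}_{y,x(c)}) V(c) V(Γ^{(j)}_{y,x(c₊)})⁻¹]`, `|B(c)| < 4L²|c₋−y| g₀ p(g₀)` (28)),
(32)–(34) p.264 (the new term `𝒫⁽ʲ⁾(g_j, Y, U) = 𝒫⁽ʲ⁾(g_j, n, B(c₁), …, B(cₙ))`, analytic on the polydisc, «polynomials in B of at least the second order and at most
the sixth» — first order vanishes by semi-simplicity (32)), (43)–(44) pp.266–267 (the OLD terms at step `k` are «the same chart B» evaluated at the chart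
configuration `B_k` of the step-`k` background, «RHS of (44) decreases by L^{−2n}» per step), (55)–(60) pp.270–271 (re-expansion in the fluctuation: the
`A⁰`-part is again the same kernel).  In d = 3 the matched levels of runs `K`, `K+1` carry the SAME coupling (`g_i^{(K)} = L^{i/2}g₀^{(K)} = g_{i+1}^{(K+1)}`,
no renormalisation), hence the same polydisc.

CONSEQUENCE (this file, sorry-free bookkeeping over schemas; nothing asserted about Bałaban's objects): the two-cutoff row FACTORS EXACTLY as

  `PolymerCauchyMinAtT(κ, a, C_tot)  ⇐  ChartFactor ∧ ChartSupCauchy(κ, a, C) ∧ ChartLipschitz(κ, C_L) ∧ ChartCfgSize(C_s) ∧ ChartCfgCauchy(a, C_B)`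

(`polymerCauchyMinAtT_of_charts`, shifts `c ≡ 0`, `C_tot = (C_s+C_B)²·C + (C_s+C_B)·C_B·C_L`), where

* `ChartSupCauchy` — THE UNPRINTED CONTENT, now DATUM-FREE: the birth charts of the matched levels `i ↔ i+1` of runs `K ↔ K+1` (two analytic functions on
  ONE fixed finite-dimensional polydisc, bonds identified by `matchBond`) agree in sup norm to relative precision `(L^{−i})^{a}` — stated in SCHWARZ FORM
  (`≤ C e^{−κ𝓛} s² (L^{−i})^{a}` on the polydisc shrunk by `s ∈ [0,1]`), which is what the two-variable Schwarz lemma gives for free from the plain sup-norm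
  statement because both charts vanish to second order at `B = 0` ((32), p.271 L5–6);
* `ChartLipschitz` — printed type: analyticity on the polydisc ⇒ Cauchy estimate for the first derivative on the shrunken polydisc (size `s`, increment `t`);
* `ChartCfgSize` — printed (28)/(44): at the trivial history and a level-`n` datum in the window `θ(n)`, the step-`k` chart configuration of a level-`i` bond
  fills the fraction `C_s·θ(n)·L^{−2(k−i)}` of the polydisc;
* `ChartCfgCauchy` — the configuration-level two-grid row ([King1986] Prop. 3.9 (3.71) in chart currency; crux idea «covariant-two-grid-galerkin»): the two
  runs' chart configurations of the same datum differ by `C_B·θ(n)·L^{−2(k−i)}·(L^{−i})^{a}` of the radius.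

The Schwarz factor `s²` returns EXACTLY the typed prefactor `θ(n)²·L^{−4(k−i)}` of the crux; the datum `V`, the window, the minimisers and the histories have
left the unprinted statement.  §4 records the elementary one-variable model of the Schwarz step (`schwarz_quadratic_model`) used in the card's dictionary.

References: T. Bałaban, CMP 102 (1985) 255–275 [Balaban1985UV3]; C. King, CMP 102 (1986) 649–677 [King1986] Props 3.8–3.9; A. Kupiainen, «Quantum field
theory without cutoffs: renormalizable and nonrenormalizable», Groningen 1985 (LNP 257) §2 (3) (continuum limit of effective actions = convergence of kernels).
-/

set_option autoImplicit false

noncomputable section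

open Literature.MathematicalPhysics.QuantumFieldTheory.Balaban1983to89
open Literature.MathematicalPhysics.QuantumFieldTheory.Balaban1983to89.T3ContinuumYM3Torus
open Literature.MathematicalPhysics.QuantumFieldTheory.Balaban1983to89.T3UnitScaleTilt
open Literature.MathematicalPhysics.QuantumFieldTheory.Balaban1983to89.T3LevelShift
open Literature.MathematicalPhysics.QuantumFieldTheory.Balaban1983to89.T3AlphaInputsAC
open Literature.MathematicalPhysics.QuantumFieldTheory.Balaban1983to89.T3AlphaPolymerSocket
open Literature.MathematicalPhysics.QuantumFieldTheory.Balaban1983to89.T3AlphaInputsACTwoRun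
open Literature.MathematicalPhysics.QuantumFieldTheory.Balaban1983to89.T3AlphaInputsACTwoRunLevel

namespace Summit.QuantumFields.YangMills.Cruxes.FluctuationComparisonRegPr.Ideate1Chart

/-! ## §1 Chart data (exposed data of the line; `𝕍` = the chart-value space, e.g. `su(2)` with any norm) -/

/-- Chart-variable configurations on the positive bonds of level `i` of run `K` (print's `(B(c))_{c ⊂ y}`, [Balaban1985UV3] (27) p.263). -/
abbrev ChartCfg (F : T3Family) (𝕍 : Type*) (K i : ℕ) : Type _ :=
  PBond (F.P K) i → 𝕍

/-- Birth charts: run `K`, birth level `i`, localisation domain `Y` (a set of finest sites) ↦ a real function of the chart configuration — print's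
`𝒫⁽ⁱ⁾(g_i, Y, ·)` of (33)–(34) (or its Taylor polynomial of order ≤ 6), INDEPENDENT of the height at which it is later read ((43): «the same chart B»). -/
abbrev ChartFn (F : T3Family) (𝕍 : Type*) : Type _ :=
  (K i : ℕ) → Set (Site (F.P K) 0) → ChartCfg F 𝕍 K i → ℝ

/-- Chart-configuration maps: run `K`, height `k`, level `i`, domain `Y` ↦ (level-`k` field `W` ↦ the chart variables `B_k(c)`, `c` a level-`i` bond, of the
trivial-history background of `W` in the `y`-gauge of `Y`) — [Balaban1985UV3] (27), (43)–(44). -/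
abbrev CfgMap (F : T3Family) (𝕍 : Type*) : Type _ :=
  (K k i : ℕ) → Set (Site (F.P K) 0) → GaugeField (F.P K) k (Matrix.specialUnitaryGroup (Fin 2) ℂ) → ChartCfg F 𝕍 K i

/-- Polydisc radii of the birth charts (print: `|B(c)| < const·|c₋ − y|`-weighted radii of the analyticity domain, (28) and Prop. 3 of [Balaban1985UV3]). -/
abbrev Radius (F : T3Family) : Type _ :=
  (K i : ℕ) → Set (Site (F.P K) 0) → PBond (F.P K) i → ℝ

/-- **THE BOND MATCHING OF THE TWO RUNS**: level `i` of run `K` and level `i+1` of run `K+1` are the same torus (`2·L^{m+K−i}` sites per direction);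
the canonical relabelling of positive bonds (`T3LevelShift.bondShift`). [cite: Balaban1987RG1, (0.1) p.251] -/
def matchBond (F : T3Family) (K i : ℕ) : PBond (F.P K) i ≃ PBond (F.P (K + 1)) (i + 1) :=
  bondShift (F.sitesPerDir_eq (m := F.m) (K := K) (j := i) (m' := F.m) (K' := K + 1) (j' := i + 1) (by omega))

/-! ## §2 The five rows (hypothesis schemas; never asserted) -/

section Schemas

variable {F : T3Family} {γ : ℝ} {𝕍 : Type*} [SeminormedAddCommGroup 𝕍]

/-- **STRUCTURE ROW** ((29) + (43) + (60), «the same chart B»): the level-`i` term of run `K` read at height `k` on the domain `Y` IS the birth chart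
`Φ K i Y` evaluated at the height-`k` chart configuration.  Discharged by DEFINING `PT` this way from the lane's `StepSeries.Ψ` / `Bcfg` / `oldVal`.
[cite: Balaban1985UV3, (29) p.263, (43)-(44) pp.266-267, (60) p.271] -/
def ChartFactor (PT : TermFn F) (Φ : ChartFn F 𝕍) (B : CfgMap F 𝕍) : Prop :=
  ∀ (K k i : ℕ) (Y : Set (Site (F.P K) 0)) (W : GaugeField (F.P K) k (Matrix.specialUnitaryGroup (Fin 2) ℂ)),
    PT K k i Y W = Φ K i Y (B K k i Y W)

/-- **THE UNPRINTED ROW, DATUM-FREE, IN SCHWARZ FORM**: on the polydisc shrunk by `s ∈ [0,1]` the birth charts of the matched levels `i` (run `K`, domain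
`Y`) and `i+1` (run `K+1`, domain `refineSet Y`), bonds identified by `matchBond`, differ by `C·e^{−κ𝓛_K(Y)}·s²·(L^{−i})^{a}`.  (Equivalent, by the Schwarz
lemma in the polydisc variables and the second-order vanishing (32) of both charts, to the plain sup-norm comparison `≤ C e^{−κ𝓛}(L^{−i})^{a}` on the full
polydisc.)  Located: [King1986] Props 3.8–3.9 for the abelian Higgs₂,₃ graphs; unprinted for [Balaban1985UV3]'s charts. [cite: King1986, Prop. 3.8-3.9 pp.664-665] -/
def ChartSupCauchy (D : AlphaDataT3 F γ) (Φ : ChartFn F 𝕍) (r : Radius F) (κ a C : ℝ) : Prop :=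
  ∀ (K k i : ℕ) (Y : Set (Site (F.P K) 0)), Y ∈ D.Loc K k (D.triv K k) i →
    ∀ s : ℝ, 0 ≤ s → s ≤ 1 →
      ∀ H : ChartCfg F 𝕍 K i, (∀ c, ‖H c‖ ≤ s * r K i Y c) →
        |Φ (K + 1) (i + 1) (refineSet F K Y) (H ∘ (matchBond F K i).symm) - Φ K i Y H| ≤
          C * Real.exp (-κ * D.treeLen K i Y) * s ^ 2 * (((F.L : ℝ) ^ i)⁻¹) ^ a

/-- **CHART LIPSCHITZ ROW** (printed type — analyticity of `𝒫⁽ⁱ⁾(g_i, Y, ·)` on the polydisc, Prop. 3 / (34) of [Balaban1985UV3], ⇒ Cauchy estimate for the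
derivative): on the polydisc shrunk by `s`, an increment of relative size `t` changes the chart by `C_L·e^{−κ𝓛}·s·t`. [cite: Balaban1985UV3, Prop. 3 (34) p.264] -/
def ChartLipschitz (D : AlphaDataT3 F γ) (Φ : ChartFn F 𝕍) (r : Radius F) (κ C_L : ℝ) : Prop :=
  ∀ (K k i : ℕ) (Y : Set (Site (F.P K) 0)), Y ∈ D.Loc K k (D.triv K k) i →
    ∀ s t : ℝ, 0 ≤ s → s ≤ 1 → 0 ≤ t →
      ∀ H H' : ChartCfg F 𝕍 K i, (∀ c, ‖H c‖ ≤ s * r K i Y c) → (∀ c, ‖H' c‖ ≤ s * r K i Y c) →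
        (∀ c, ‖H c - H' c‖ ≤ t * r K i Y c) →
          |Φ K i Y H - Φ K i Y H'| ≤ C_L * Real.exp (-κ * D.treeLen K i Y) * s * t

/-- **CHART-CONFIGURATION SIZE ROW** (printed (28)/(44): at the trivial history and a level-`n` datum in the window `θ(n)`, the height-`(K−n)` chart
configuration on a level-`(1+j)` bond fills the fraction `C_s·θ(n)·L^{−2(K−n−1−j)}` of the polydisc). [cite: Balaban1985UV3, (28) p.263, (44) p.267] -/
def ChartCfgSize (D : AlphaDataT3 F γ) (B : CfgMap F 𝕍) (r : Radius F) (b₀ p₀ C_s : ℝ) : Prop :=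
  ∀ (K n : ℕ) (h : n ≤ K), ∀ j : ℕ, j < K - n →
    ∀ V : GaugeField (F.P n) 0 (Matrix.specialUnitaryGroup (Fin 2) ℂ), PlaqSmall (θBal F.L γ b₀ p₀ n) V →
      ∀ Y ∈ D.Loc K (K - n) (D.triv K (K - n)) (1 + j), ∀ c : PBond (F.P K) (1 + j),
        ‖B K (K - n) (1 + j) Y
            (fieldShift (F.sitesPerDir_eq (m := F.m) (K := K) (j := K - n) (m' := F.m) (K' := n) (j' := 0) (by omega)) V) c‖ ≤
          C_s * θBal F.L γ b₀ p₀ n * (((F.L : ℝ) ^ (K - n - 1 - j))⁻¹) ^ 2 * r K (1 + j) Y c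

/-- **CHART-CONFIGURATION CAUCHY ROW** (the configuration-level two-grid comparison, [King1986] Prop. 3.9 (3.71) in chart currency; supplied by the crux idea
«covariant-two-grid-galerkin»): the chart configurations of the SAME datum in runs `K+1` (height `K+1−n`, level `j+2`, domain `refineSet Y`, bond `matchBond c`)
and `K` (height `K−n`, level `1+j`, domain `Y`, bond `c`) differ by `C_B·θ(n)·L^{−2(K−n−1−j)}·(L^{−(1+j)})^{a}` of the radius. [cite: King1986, Prop. 3.9 (3.71) p.665] -/
def ChartCfgCauchy (D : AlphaDataT3 F γ) (B : CfgMap F 𝕍) (r : Radius F) (b₀ p₀ a C_B : ℝ) : Prop :=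
  ∀ (K n : ℕ) (h : n ≤ K), ∀ j : ℕ, j < K - n →
    ∀ V : GaugeField (F.P n) 0 (Matrix.specialUnitaryGroup (Fin 2) ℂ), PlaqSmall (θBal F.L γ b₀ p₀ n) V →
      ∀ Y ∈ D.Loc K (K - n) (D.triv K (K - n)) (1 + j), ∀ c : PBond (F.P K) (1 + j),
        ‖B (K + 1) (K + 1 - n) (1 + (j + 1)) (refineSet F K Y)
              (fieldShift (F.sitesPerDir_eq (m := F.m) (K := K + 1) (j := K + 1 - n) (m' := F.m) (K' := n) (j' := 0) (by omega)) V)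
              (matchBond F K (1 + j) c) -
            B K (K - n) (1 + j) Y
              (fieldShift (F.sitesPerDir_eq (m := F.m) (K := K) (j := K - n) (m' := F.m) (K' := n) (j' := 0) (by omega)) V) c‖ ≤
          C_B * θBal F.L γ b₀ p₀ n * (((F.L : ℝ) ^ (K - n - 1 - j))⁻¹) ^ 2 * (((F.L : ℝ) ^ (1 + j))⁻¹) ^ a * r K (1 + j) Y c

end Schemas

/-! ## §3 The factorisation theorem -/

section Factorisation

variable {F : T3Family} {γ : ℝ} {𝕍 : Type*} [SeminormedAddCommGroup 𝕍]

/-- Scalar bookkeeping of the two-piece estimate: a Schwarz piece `C·E·s²·R` and a Lipschitz piece `C_L·E·s·t` with `s = (C_s+C_B)·θ·x²`,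
`t = C_B·θ·x²·R` add up to `((C_s+C_B)²C + (C_s+C_B)C_B C_L)·E·θ²·x⁴·R`. -/
theorem two_piece_alg {d₁ d₂ C C_L C_s C_B θ x R E s t : ℝ}
    (hs : s = (C_s + C_B) * θ * x ^ 2) (ht : t = C_B * θ * x ^ 2 * R)
    (h₁ : |d₁| ≤ C * E * s ^ 2 * R) (h₂ : |d₂| ≤ C_L * E * s * t) :
    |d₁ + d₂| ≤ ((C_s + C_B) ^ 2 * C + (C_s + C_B) * C_B * C_L) * E * θ ^ 2 * x ^ 4 * R := by
  calc |d₁ + d₂| ≤ |d₁| + |d₂| := abs_add_le _ _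
    _ ≤ C * E * s ^ 2 * R + C_L * E * s * t := add_le_add h₁ h₂
    _ = ((C_s + C_B) ^ 2 * C + (C_s + C_B) * C_B * C_L) * E * θ ^ 2 * x ^ 4 * R := by rw [hs, ht]; ring

/-- **THE SAME-CHART SCHWARZ TRANSFER.**  Structure row + the datum-free chart comparison (Schwarz form) + chart Lipschitz + configuration size + configuration
Cauchy ⟹ the two-cutoff row `PolymerCauchyMinAtT D PT b₀ p₀ κ a C_tot` with shifts `c ≡ 0` and `C_tot = (C_s+C_B)²·C + (C_s+C_B)·C_B·C_L`, provided the
window keeps the configurations inside the unit polydisc (`(C_s+C_B)·θ(n) ≤ 1`).  The Schwarz factor `s²` IS the typed prefactor `θ(n)²·L^{−4(K−n−1−j)}`.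
[cite: Balaban1985UV3, (29) p.263, (43)-(44) pp.266-267; King1986, Prop. 3.8-3.9 pp.664-665] -/
theorem polymerCauchyMinAtT_of_charts {D : AlphaDataT3 F γ} {PT : TermFn F} {Φ : ChartFn F 𝕍} {B : CfgMap F 𝕍} {r : Radius F}
    {b₀ p₀ κ a C C_L C_s C_B : ℝ}
    (hCs : 0 ≤ C_s) (hCB : 0 ≤ C_B) (ha : 0 ≤ a) (hL : 1 ≤ (F.L : ℝ))
    (hθ0 : ∀ n, 0 ≤ θBal F.L γ b₀ p₀ n) (hθ1 : ∀ n, (C_s + C_B) * θBal F.L γ b₀ p₀ n ≤ 1)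
    (hr : ∀ K i Y c, 0 ≤ r K i Y c)
    (hF : ChartFactor PT Φ B) (hΦ : ChartSupCauchy D Φ r κ a C) (hLip : ChartLipschitz D Φ r κ C_L)
    (hS : ChartCfgSize D B r b₀ p₀ C_s) (hBC : ChartCfgCauchy D B r b₀ p₀ a C_B) :
    PolymerCauchyMinAtT D PT b₀ p₀ κ a ((C_s + C_B) ^ 2 * C + (C_s + C_B) * C_B * C_L) := by
  refine ⟨fun _ _ _ _ => 0, ?_⟩
  intro K n h j hj V hV Y hY
  rw [hF, hF, sub_zero]
  -- instances of the two configuration rows at this (K, n, j, V, Y)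
  have hSz := hS K n h j hj V hV Y hY
  have hCy := hBC K n h j hj V hV Y hY
  -- scalar sizes
  have hθn : 0 ≤ θBal F.L γ b₀ p₀ n := hθ0 n
  have hx0 : 0 ≤ ((F.L : ℝ) ^ (K - n - 1 - j))⁻¹ := by positivity
  have hx1 : ((F.L : ℝ) ^ (K - n - 1 - j))⁻¹ ≤ 1 := inv_le_one_of_one_le₀ (one_le_pow₀ hL)
  have hP1 : (((F.L : ℝ) ^ (K - n - 1 - j))⁻¹) ^ 2 ≤ 1 := pow_le_one₀ hx0 hx1
  have hR0 : 0 ≤ (((F.L : ℝ) ^ (1 + j))⁻¹) ^ a := Real.rpow_nonneg (by positivity) _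
  have hR1 : (((F.L : ℝ) ^ (1 + j))⁻¹) ^ a ≤ 1 :=
    Real.rpow_le_one (by positivity) (inv_le_one_of_one_le₀ (one_le_pow₀ hL)) ha
  -- the Schwarz parameter `s` (polydisc fraction filled by both configurations) and the Lipschitz increment `t`
  obtain ⟨s, hs⟩ : ∃ s : ℝ, s = (C_s + C_B) * θBal F.L γ b₀ p₀ n * (((F.L : ℝ) ^ (K - n - 1 - j))⁻¹) ^ 2 := ⟨_, rfl⟩
  obtain ⟨t, ht⟩ : ∃ t : ℝ,
      t = C_B * θBal F.L γ b₀ p₀ n * (((F.L : ℝ) ^ (K - n - 1 - j))⁻¹) ^ 2 * (((F.L : ℝ) ^ (1 + j))⁻¹) ^ a := ⟨_, rfl⟩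
  have hs0 : 0 ≤ s := by rw [hs]; positivity
  have hs1 : s ≤ 1 := by
    rw [hs]
    calc (C_s + C_B) * θBal F.L γ b₀ p₀ n * (((F.L : ℝ) ^ (K - n - 1 - j))⁻¹) ^ 2
        ≤ 1 * 1 := mul_le_mul (hθ1 n) hP1 (by positivity) zero_le_one
      _ = 1 := one_mul 1
  have ht0 : 0 ≤ t := by rw [ht]; positivity
  have hst : C_s * θBal F.L γ b₀ p₀ n * (((F.L : ℝ) ^ (K - n - 1 - j))⁻¹) ^ 2 + t ≤ s := by
    rw [hs, ht]
    have h0 : 0 ≤ C_B * θBal F.L γ b₀ p₀ n * (((F.L : ℝ) ^ (K - n - 1 - j))⁻¹) ^ 2 := by positivity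
    nlinarith [mul_le_mul_of_nonneg_left hR1 h0]
  have hCs_le_s : C_s * θBal F.L γ b₀ p₀ n * (((F.L : ℝ) ^ (K - n - 1 - j))⁻¹) ^ 2 ≤ s := by linarith
  -- the three chart configurations: run K's (`H₀`), run (K+1)'s (`H₁'`), and the latter pulled back along the bond matching (`H₁`)
  set H₀ : ChartCfg F 𝕍 K (1 + j) := B K (K - n) (1 + j) Y
      (fieldShift (F.sitesPerDir_eq (m := F.m) (K := K) (j := K - n) (m' := F.m) (K' := n) (j' := 0) (by omega)) V) with hH₀
  set H₁' : ChartCfg F 𝕍 (K + 1) (1 + (j + 1)) := B (K + 1) (K + 1 - n) (1 + (j + 1)) (refineSet F K Y)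
      (fieldShift (F.sitesPerDir_eq (m := F.m) (K := K + 1) (j := K + 1 - n) (m' := F.m) (K' := n) (j' := 0) (by omega)) V) with hH₁'
  set e := matchBond F K (1 + j) with he
  have hfill₀ : ∀ c, ‖H₀ c‖ ≤ s * r K (1 + j) Y c := fun c =>
    (hSz c).trans (mul_le_mul_of_nonneg_right hCs_le_s (hr K (1 + j) Y c))
  have hdiff : ∀ c, ‖H₁' (e c) - H₀ c‖ ≤ t * r K (1 + j) Y c := fun c => by
    have h1 := hCy c
    rw [ht]
    exact h1
  have hfill₁ : ∀ c, ‖H₁' (e c)‖ ≤ s * r K (1 + j) Y c := fun c => by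
    have hsplit : H₁' (e c) = H₀ c + (H₁' (e c) - H₀ c) := by abel
    calc ‖H₁' (e c)‖ = ‖H₀ c + (H₁' (e c) - H₀ c)‖ := by rw [← hsplit]
      _ ≤ ‖H₀ c‖ + ‖H₁' (e c) - H₀ c‖ := norm_add_le _ _
      _ ≤ C_s * θBal F.L γ b₀ p₀ n * (((F.L : ℝ) ^ (K - n - 1 - j))⁻¹) ^ 2 * r K (1 + j) Y c + t * r K (1 + j) Y c :=
          add_le_add (hSz c) (hdiff c)
      _ = (C_s * θBal F.L γ b₀ p₀ n * (((F.L : ℝ) ^ (K - n - 1 - j))⁻¹) ^ 2 + t) * r K (1 + j) Y c := by ring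
      _ ≤ s * r K (1 + j) Y c := mul_le_mul_of_nonneg_right hst (hr K (1 + j) Y c)
  -- the pulled-back configuration read through `e.symm` is run (K+1)'s configuration
  have hback : ((fun c => H₁' (e c)) ∘ (matchBond F K (1 + j)).symm) = H₁' := by
    funext c'
    simp [he]
  -- the two chart estimates
  have h₁ := hΦ K (K - n) (1 + j) Y hY s hs0 hs1 (fun c => H₁' (e c)) hfill₁
  rw [hback] at h₁
  have h₂ := hLip K (K - n) (1 + j) Y hY s t hs0 hs1 ht0 (fun c => H₁' (e c)) H₀ hfill₁ hfill₀ hdiff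
  -- combine
  have key := two_piece_alg (C := C) (C_L := C_L) (C_s := C_s) (C_B := C_B) (E := Real.exp (-κ * D.treeLen K (1 + j) Y)) hs ht h₁ h₂
  have hsplit : Φ (K + 1) (1 + (j + 1)) (refineSet F K Y) H₁' - Φ K (1 + j) Y H₀ =
      (Φ (K + 1) (1 + (j + 1)) (refineSet F K Y) H₁' - Φ K (1 + j) Y (fun c => H₁' (e c))) +
        (Φ K (1 + j) Y (fun c => H₁' (e c)) - Φ K (1 + j) Y H₀) := by ring
  rw [hsplit]
  calc _ ≤ _ := key
    _ = _ := by ring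

/-- **THE BUNDLE.**  With print's rows at rate `κ` (`TermSizeTrivT`, `LocCover`, `LocBlockVolume`, `LocMatched` — all printed / S-E″ bookkeeping) the chart
rows at the same rate give the (C)-bundle `TwoRunMinT D PT b₀ p₀ a` consumed by `levelCauchyOfTwoRunMinT_dec` /
`LogComparisonAlphaAdapter.stub_alphaTwoRunOfLaneT_of_rows`. [cite: Balaban1985UV3, (43)-(46) pp.266-267; King1986, Prop. 3.8-3.9 pp.664-665] -/
theorem twoRunMinT_of_charts {D : AlphaDataT3 F γ} {PT : TermFn F} {Φ : ChartFn F 𝕍} {B : CfgMap F 𝕍} {r : Radius F}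
    {b₀ p₀ κ a C C_L C_s C_B C₁ C' : ℝ}
    (hCs : 0 ≤ C_s) (hCB : 0 ≤ C_B) (ha : 0 ≤ a) (hL : 1 ≤ (F.L : ℝ))
    (hθ0 : ∀ n, 0 ≤ θBal F.L γ b₀ p₀ n) (hθ1 : ∀ n, (C_s + C_B) * θBal F.L γ b₀ p₀ n ≤ 1)
    (hr : ∀ K i Y c, 0 ≤ r K i Y c)
    (hsize : TermSizeTrivT D PT b₀ p₀ C₁ κ) (hcov : LocCover D κ C') (hvol : LocBlockVolume D) (hmatch : LocMatched D)
    (hF : ChartFactor PT Φ B) (hΦ : ChartSupCauchy D Φ r κ a C) (hLip : ChartLipschitz D Φ r κ C_L)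
    (hS : ChartCfgSize D B r b₀ p₀ C_s) (hBC : ChartCfgCauchy D B r b₀ p₀ a C_B) :
    TwoRunMinT D PT b₀ p₀ a :=
  ⟨κ, ⟨C₁, hsize⟩, ⟨C', hcov⟩, hvol, hmatch, ⟨_, polymerCauchyMinAtT_of_charts hCs hCB ha hL hθ0 hθ1 hr hF hΦ hLip hS hBC⟩⟩

end Factorisation

/-! ## §4 The one-variable model of the Schwarz step (dictionary entry; elementary) -/

/-- MODEL OF THE SCHWARZ STEP for a degree-2 chart: if `|q| ≤ M` bounds the quadratic chart `z ↦ q·z²` on the unit disc (`|q·1²| ≤ M`), then on the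
disc shrunk by `s` it is bounded by `M·s²` — the shape `sup-norm comparison on the full polydisc ⇒ s²-weighted comparison on the shrunken one` that
`ChartSupCauchy` encodes (for degree-≥2 analytic charts this is the Schwarz lemma). -/
theorem schwarz_quadratic_model {q M s z : ℝ} (hq : |q| ≤ M) (hz : |z| ≤ s) : |q * z ^ 2| ≤ M * s ^ 2 := by
  rw [abs_mul, abs_pow]
  have hz0 : 0 ≤ |z| := abs_nonneg z
  have h2 : |z| ^ 2 ≤ s ^ 2 := pow_le_pow_left₀ hz0 hz 2
  exact mul_le_mul hq h2 (by positivity) ((abs_nonneg q).trans hq)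

end Summit.QuantumFields.YangMills.Cruxes.FluctuationComparisonRegPr.Ideate1Chart

end
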